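import Summits.NavierStokesRegularity.NavierStokesRegularity.Theorems.SqueezeCycleExtremalBiaxialitySubcriticalQuarterBootstrap
import Summits.NavierStokesRegularity.NavierStokesRegularity.Theorems.SqueezeCycleExtremalBiaxialitySubcriticalLeakyQuarterLawCeiling
import HarnessLib

/-!
# Route `SqueezeCycle`, crux `ExtremalBiaxialitySubcritical` — the crux IS its open stub (line `quarter-bootstrap-pinning`, closed modulo one stub)

Helper file for item `stmt-NavierStokesRegularity-11609`
(`Summit.NavierStokesRegularity.NavierStokesRegularity.Theses.SqueezeCycle.ExtremalBiaxialitySubcritical`).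
Line `quarter-bootstrap-pinning` had four registered stubs; three are now theorems —
`stub_gaugeStrainBound` (p72389), `stub_cubicProductionBound` (p72572) and
`stub_leakyQuarterLawCeiling` (p77091, the sibling crux `MustSqueeze`'s engine in production-ceiling
currency at every threshold `b < ¼`) — so the line's composition is a theorem with exactly ONE
hypothesis, the open stub `stub_largeExcessExclusion` (no extremal configuration with
`¼ ≤ m − 2m³/K²`). Together with the trivial converse
(`largeExcessExclusion_of_extremalBiaxialitySubcritical`, p74816) this file records

  `ExtremalBiaxialitySubcritical ↔ stub_largeExcessExclusion`  (registered signature, verbatim):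

the open stub is not a lemma toward the crux but the crux itself (equivalently, by the refuters'
landed calibration, the pointwise a-priori bound "`Λ ≤ ¼` at every point of every `𝒦_C`", i.e. the
route target `SqueezeLiouville` now that `MustSqueeze` is proved). This is the line lead's handover
statement for the planner (promote / re-line the stub).
-/

noncomputable section

open MeasureTheory Set Filter Topology
open scoped RealInnerProductSpace Matrix

namespace Summit.NavierStokesRegularity.NavierStokesRegularity.Theorems

open Literature.Analysis.FluidPDE
open Summit.NavierStokesRegularity.NavierStokesRegularity.Theses.SqueezeCycle

/-- **The crux is equivalent to the large-excess exclusion** (the single open stub of line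
`quarter-bootstrap-pinning`, registered signature verbatim). `→`: p74816
(`largeExcessExclusion_of_extremalBiaxialitySubcritical`). `←`: the line's composition with its three
landed stubs — class-uniform strain constant `K(C)` (`stub_gaugeStrainBound`), `m ≥ 0`
(`nonneg_of_maximal`); on `¼ ≤ m − 2m³/K²` the hypothesis; otherwise `6m² ≤ K²` at the attainment
point (`six_mul_midStrain_sq_le`), the cubic ceiling (`stub_cubicProductionBound` at `(m/(−t), K/(−t))`)
turns the class ceiling `Λ ≤ m` into the production ceiling at `b = m − 2m³/K² < ¼`, the leaky quarter
law (`stub_leakyQuarterLawCeiling`) kills the extremal element, and attainment forces `m ≤ 0 < 1/8`. [folklore] -/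
theorem extremalBiaxialitySubcritical_iff_largeExcessExclusion :
    Summit.NavierStokesRegularity.NavierStokesRegularity.Theses.SqueezeCycle.ExtremalBiaxialitySubcritical ↔ (∀ (C K m : ℝ) (u : ℝ → EuclideanSpace ℝ (Fin 3) → EuclideanSpace ℝ (Fin 3)) (t₀ : ℝ) (x₀ : EuclideanSpace ℝ (Fin 3)), 0 < K → (∀ (v' : ℝ → EuclideanSpace ℝ (Fin 3) → EuclideanSpace ℝ (Fin 3)), ContDiffOn ℝ (⊤ : ℕ∞) (Function.uncurry v') (Set.Iio 0 ×ˢ Set.univ) ∧ (∀ t < 0, Literature.Analysis.FluidPDE.VectorCalculus.IsDivFree (v' t)) ∧ (∀ s t : ℝ, s < t → t < 0 → ∀ x, v' t x = Literature.Analysis.FluidPDE.heatFlow (v' s) (t-s) x - ∫ τ in Set.Ioo s t, ∫ y, ((-(inner ℝ (x-y) (v' τ y) / (2*(t-τ)) * Literature.Analysis.UnboundedOperators.heatKernel (t-τ) (x-y))) • v' τ y + (∫ σ in Set.Ioi (t-τ), Literature.Analysis.UnboundedOperators.heatKernel σ (x-y) / (4*σ^2)) • (inner ℝ (x-y) (v'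 τ y) • v' τ y + inner ℝ (v' τ y) (v' τ y) • (x-y) + inner ℝ (x-y) (v' τ y) • v' τ y) - ((∫ σ in Set.Ioi (t-τ), Literature.Analysis.UnboundedOperators.heatKernel σ (x-y) / (8*σ^3)) * (inner ℝ (x-y) (v' τ y) * inner ℝ (x-y) (v' τ y))) • (x-y))) ∧ Literature.Analysis.FluidPDE.HasTypeITimeDecay C v' ∧ (∀ (x₀ : EuclideanSpace ℝ (Fin 3)) (t₀ r : ℝ), t₀ ≤ 0 → 0 < r → (∀ t, t₀ - r^2 < t → t < t₀ → r⁻¹ * ∫ x in Metric.ball x₀ r, ‖v' t x‖^2 ≤ C) ∧ r⁻¹ * ∫ t in Set.Ioo (t₀ - r^2) t₀, ∫ x in Metric.ball x₀ r, ‖fderiv ℝ (v' t) x‖^2 ≤ C) → ∀ t < 0, ∀ x, (∑ i, ∑ j, (((1 / 2 : ℝ) • (Literature.Analysis.FluidPDE.stdMatrix (fderiv ℝ (v' t) x : EuclideanSpace ℝ (Fin 3) →ₗ[ℝ] EuclideanSpace ℝ (Fin 3)) + (Literature.Analysis.FluidPDE.stdMatrix (fderiv ℝ (v' t) x : EuclideanSpace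 ℝ (Fin 3) →ₗ[ℝ] EuclideanSpace ℝ (Fin 3)))ᵀ)) i j) ^ 2) ≤ (K / (-t)) ^ 2 ∧ Literature.Analysis.FluidPDE.lerayMiddleStrain v' t x ≤ m) → 0 ≤ m → 1 / 4 ≤ m - 2 * m ^ 3 / K ^ 2 → t₀ < 0 → (ContDiffOn ℝ (⊤ : ℕ∞) (Function.uncurry u) (Set.Iio 0 ×ˢ Set.univ) ∧ (∀ t < 0, Literature.Analysis.FluidPDE.VectorCalculus.IsDivFree (u t)) ∧ (∀ s t : ℝ, s < t → t < 0 → ∀ x, u t x = Literature.Analysis.FluidPDE.heatFlow (u s) (t-s) x - ∫ τ in Set.Ioo s t, ∫ y, ((-(inner ℝ (x-y) (u τ y) / (2*(t-τ)) * Literature.Analysis.UnboundedOperators.heatKernel (t-τ) (x-y))) • u τ y + (∫ σ in Set.Ioi (t-τ), Literature.Analysis.UnboundedOperators.heatKernel σ (x-y) / (4*σ^2)) • (inner ℝ (x-y) (u τ y) • u τ y + inner ℝ (u τ y) (u τ y) • (x-y) + inner ℝ (x-y) (u τ y) • u τ y) - ((∫ σ in Set.Ioi (t-τ), Literature.Analysis.UnboundedOperators.heatKernel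 σ (x-y) / (8*σ^3)) * (inner ℝ (x-y) (u τ y) * inner ℝ (x-y) (u τ y))) • (x-y))) ∧ Literature.Analysis.FluidPDE.HasTypeITimeDecay C u ∧ (∀ (x₀ : EuclideanSpace ℝ (Fin 3)) (t₀ r : ℝ), t₀ ≤ 0 → 0 < r → (∀ t, t₀ - r^2 < t → t < t₀ → r⁻¹ * ∫ x in Metric.ball x₀ r, ‖u t x‖^2 ≤ C) ∧ r⁻¹ * ∫ t in Set.Ioo (t₀ - r^2) t₀, ∫ x in Metric.ball x₀ r, ‖fderiv ℝ (u t) x‖^2 ≤ C)) → m ≤ Literature.Analysis.FluidPDE.lerayMiddleStrain u t₀ x₀ → False) := by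
  refine ⟨largeExcessExclusion_of_extremalBiaxialitySubcritical, fun stub_largeExcessExclusion => ?_⟩
  intro C m u t₀ x₀ ht₀ hu hGE hmax
  -- the class-uniform gauge strain bound
  obtain ⟨K, hK, hKb⟩ := stub_gaugeStrainBound C
  -- calibration: `C ≥ 0`, `m ≥ 0`
  have hC : 0 ≤ C := squeezeClass_constant_nonneg hu.2.2.2.1
  have hm0 : 0 ≤ m := nonneg_of_maximal hC hmax
  -- the two clauses in `lerayMiddleStrain` form
  obtain ⟨hΛeq, hΛle⟩ := extremal_lerayMiddleStrain_eq ht₀ hu hGE hmax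
  by_cases hreg : 1 / 4 ≤ m - 2 * m ^ 3 / K ^ 2
  · -- ## large excess: the open stub
    exact (stub_largeExcessExclusion C K m u t₀ x₀ hK
      (fun v' hv' t ht x => ⟨hKb v' hv' t ht x, hΛle v' hv' t ht x⟩) hm0 hreg ht₀ hu hΛeq.ge).elim
  · -- ## small excess: bootstrap through the production ceiling
    replace hreg : m - 2 * m ^ 3 / K ^ 2 < 1 / 4 := not_le.1 hreg
    set b : ℝ := m - 2 * m ^ 3 / K ^ 2 with hb
    obtain ⟨h1, h2, h3, h4, h5⟩ := hu
    -- trace-free velocity gradients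
    have htr : ∀ t < 0, ∀ x, (stdMatrix (fderiv ℝ (u t) x : EuclideanSpace ℝ (Fin 3) →ₗ[ℝ] EuclideanSpace ℝ (Fin 3))).trace = 0 := by
      intro t ht x
      rw [trace_stdMatrix]
      exact h2 t ht x
    -- `6 m² ≤ K²` from the attained value
    have h6 : 6 * m ^ 2 ≤ K ^ 2 := by
      have ht' : 0 < -t₀ := neg_pos.2 ht₀
      set M := stdMatrix (fderiv ℝ (u t₀) x₀ : EuclideanSpace ℝ (Fin 3) →ₗ[ℝ] EuclideanSpace ℝ (Fin 3)) with hM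
      have hsix := six_mul_midStrain_sq_le M (htr t₀ ht₀ x₀)
      have hS := hKb u ⟨h1, h2, h3, h4, h5⟩ t₀ ht₀ x₀
      have hΛ : lerayMiddleStrain u t₀ x₀ =
          (-t₀) * (2⁻¹ * (Matrix.isHermitian_add_transpose_self M).eigenvalues₀ 1) :=
        lerayMiddleStrain_eq_eigenvalues₀
      rw [hΛeq] at hΛ
      -- `m = (-t₀) μ₁ / 2`, so `6 m² = (3/2) (-t₀)² μ₁² ≤ (-t₀)² Σ S² ≤ K²`
      have hKt : ((K / (-t₀)) ^ 2) * (-t₀) ^ 2 = K ^ 2 := by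
        have ht0 : t₀ ≠ 0 := ht₀.ne
        field_simp
      set σ := ∑ i, ∑ j, (((1 / 2 : ℝ) • (M + Mᵀ)) i j) ^ 2 with hσ
      set μ := (Matrix.isHermitian_add_transpose_self M).eigenvalues₀ 1 with hμ
      have hσK : σ * (-t₀) ^ 2 ≤ K ^ 2 := by
        rw [← hKt]
        exact mul_le_mul_of_nonneg_right hS (sq_nonneg _)
      calc 6 * m ^ 2 = (3 / 2 * μ ^ 2) * (-t₀) ^ 2 := by rw [hΛ]; ring
        _ ≤ σ * (-t₀) ^ 2 := mul_le_mul_of_nonneg_right hsix (sq_nonneg _)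
        _ ≤ K ^ 2 := hσK
    -- the production ceiling at every point of `u`
    have hceil : ∀ t < 0, ∀ x,
        -4 * (((1 / 2 : ℝ) • (Literature.Analysis.FluidPDE.stdMatrix (fderiv ℝ (u t) x : EuclideanSpace ℝ (Fin 3) →ₗ[ℝ] EuclideanSpace ℝ (Fin 3)) + (Literature.Analysis.FluidPDE.stdMatrix (fderiv ℝ (u t) x : EuclideanSpace ℝ (Fin 3) →ₗ[ℝ] EuclideanSpace ℝ (Fin 3)))ᵀ))).det ≤ (2 * b / (-t)) * (∑ i, ∑ j, (((1 / 2 : ℝ) • (Literature.Analysis.FluidPDE.stdMatrix (fderiv ℝ (u t) x : EuclideanSpace ℝ (Fin 3) →ₗ[ℝ] EuclideanSpace ℝ (Fin 3)) + (Literature.Analysis.FluidPDE.stdMatrix (fderiv ℝ (u t) x : EuclideanSpace ℝ (Fin 3) →ₗ[ℝ] EuclideanSpace ℝ (Fin 3)))ᵀ)) i j) ^ 2) := by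
      intro t ht x
      have ht' : 0 < -t := neg_pos.2 ht
      set M := stdMatrix (fderiv ℝ (u t) x : EuclideanSpace ℝ (Fin 3) →ₗ[ℝ] EuclideanSpace ℝ (Fin 3)) with hM
      -- the ceiling `μ₁ ≤ 2 m / (-t)` from `Λ_u(t,x) ≤ m`
      have hΛle_u : lerayMiddleStrain u t x ≤ m := hΛle u ⟨h1, h2, h3, h4, h5⟩ t ht x
      have hΛ : lerayMiddleStrain u t x =
          (-t) * (2⁻¹ * (Matrix.isHermitian_add_transpose_self M).eigenvalues₀ 1) :=
        lerayMiddleStrain_eq_eigenvalues₀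
      have hμ : (Matrix.isHermitian_add_transpose_self M).eigenvalues₀ 1 ≤ 2 * (m / (-t)) := by
        rw [hΛ] at hΛle_u
        rw [mul_div_assoc', le_div_iff₀ ht']
        nlinarith
      have hmK : 6 * (m / (-t)) ^ 2 ≤ (K / (-t)) ^ 2 := by
        rw [div_pow, div_pow]
        exact (by
          rw [← mul_div_assoc]
          exact div_le_div_of_nonneg_right h6 (sq_nonneg _) :
            6 * (m ^ 2 / (-t) ^ 2) ≤ K ^ 2 / (-t) ^ 2)
      have hcub := stub_cubicProductionBound M (m / (-t)) (K / (-t)) (htr t ht x)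
        (div_nonneg hm0 ht'.le) (div_pos hK ht') hmK hμ (hKb u ⟨h1, h2, h3, h4, h5⟩ t ht x)
      have hcoef : 2 * (m / (-t)) - 4 * (m / (-t)) ^ 3 / (K / (-t)) ^ 2 = 2 * b / (-t) := by
        rw [hb]
        field_simp
        ring
      rw [hcoef] at hcub
      exact hcub
    -- the leaky quarter law kills `u`
    have hz : ∀ t < 0, ∀ x, u t x = 0 :=
      stub_leakyQuarterLawCeiling C b hreg u ⟨h1, h2, h3, h4, h5⟩ hceil
    have hm : m ≤ 0 := nonpos_of_twoFrame_lower_of_slice_zero (hz t₀ ht₀) hGE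
    linarith

end Summit.NavierStokesRegularity.NavierStokesRegularity.Theorems

end
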